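/-
Copyright (c) 2026 the pub-hodgecm-mathlib formalisation cell (harness21).  Prover seat hodgecm-mathlib-K2Liu-p25 (g2), Track B «K2-LIT» ∕ hLiu418
#184♮ = `stmt-HodgeConjecture-24832`, socket #41 — ORGAN (T) END: THE (R-c) ARCHIMEDEAN TRANSPORT IN ONE DECL (LEAD F0P6-plan (g14) RULING «M-158j», BATCH #70 (1) ∕
#82 (3); (T3-arch) by LH4-p17 (g2)).  THEOREMS ONLY (no `def`, no instance, no notation, no `sorry`).
-/
import Summits.HodgeConjecture.HodgeConjecture.Theorems.K2LiuSiegelEisensteinConjugateDatumTransport   -- ★ (T) glue `continuation_of_conjDatum`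
import Summits.HodgeConjecture.HodgeConjecture.Theorems.K2LiuIwasawaDatumConjStd                      -- ★ (T) §5 `isStd_of_conj`
import Summits.HodgeConjecture.HodgeConjecture.Theorems.K2LiuArchMajorantTransitivity                  -- ★ (T3-arch) `exists_isSiegelDelta_conjDatum_arch_iff` (LH4-p17)
import HarnessLib

/-!
# Crux `HLiu418`, socket #41, ORGAN (T) END: #41 AT EVERY STANDARD DATUM FROM #41 ON THE ARCHIMEDEAN CLASS OF ONE STANDARD REFERENCE DATUM

Cell `hodgecm-mathlib`, crux item hLiu418 = `stmt-HodgeConjecture-24832`; squad K2 ∕ K2Liu (L1, LEAD F0P6-plan (g14)); prover K2Liu-p25 (g2).  THEOREMS ONLY; lane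
`--supports stmt-HodgeConjecture-24832 --as helper`.

ROAD (R-c) OF RULING «M-158j», END TO END BY NAME.  Fix a standard reference datum `𝒦₁` (the I-lineage's Levi-compatible one, e.g. the tree's `K₉`).  Its ARCHIMEDEAN CLASS =
the standard data `𝒦` with the same archimedean compact: `∀ a ∈ H(L⁺⊗ℝ), (a, 1) ∈ 𝒦.K ↔ (a, 1) ∈ 𝒦₁.K` (finite part arbitrary).  ★ (T3-arch)
`K2LiuArchMajorantTransitivity.exists_isSiegelDelta_conjDatum_arch_iff` (LH4-p17): every standard `𝒦₂` is `P_Δ(L⁺⊗ℝ)`-conjugate to a datum `𝒦` of that class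
(`k ∈ 𝒦.K ↔ p⁻¹ k p ∈ 𝒦₂.K`); ★ (T) §5 `isStd_of_conj`: that `𝒦` is standard; ★ (T) glue `continuation_of_conjDatum`: socket #41's conclusion passes from `𝒦` to `𝒦₂`.
HENCE **`continuation_of_archReference`**: if socket #41's conclusion holds for every standard continuous family of EVERY STANDARD DATUM OF THE ARCHIMEDEAN CLASS OF `𝒦₁`,
it holds for every standard continuous family of EVERY standard datum — the ONE decl the #41 TOP cites to serve the socket's `∀ 𝒦, 𝒦.IsStd → …` from the class the
I-lineage proves (its finite side is road (R-a): preimage level, ★ `K2LiuSiegelLeviArchPart.exists_level_letters_of_blk`).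
References: [MoeglinWaldspurger1995, II.1.5, IV.1.8]; [BorelJacquet1979, §1.2, §4.1]; [Weil1964, Chap. I n° 8]; [Tan1999, §1].
HONEST LABEL.  Count-neutral helper: `HC_CM` is proved only modulo the 7 printed citations (2 remaining named inputs: hLiu418 = `stmt-HodgeConjecture-24832`,
h413 = `stmt-HodgeConjecture-24833`) until rung 0 closes; this file closes no socket (the hypothesis `h41` on the archimedean class is the I-lineage's theorem to come).
-/

set_option autoImplicit false
set_option linter.dupNamespace false -- the mandated namespace repeats `HodgeConjecture.HodgeConjecture`

noncomputable section

open scoped Matrix Topology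
open NumberField IsDedekindDomain Filter Set Metric
open Literature.NumberTheory.Automorphic Literature.NumberTheory.Automorphic.UnitaryGroup Literature.NumberTheory.GaloisRepresentations
open Literature.NumberTheory.GelbartRogawski1991 Literature.NumberTheory.GelbartRogawski1991.GRConstruction
open Literature.NumberTheory.K2Lit.SiegelDoubled

namespace Summit.HodgeConjecture.HodgeConjecture.Cruxes.HLiu418.K2LiuSiegelEisensteinArchClassTransport

open Summit.HodgeConjecture.HodgeConjecture.Cruxes.HLiu418.K2LiuSiegelEisensteinConjugateDatumTransport (continuation_of_conjDatum)
open Summit.HodgeConjecture.HodgeConjecture.Cruxes.HLiu418.K2LiuIwasawaDatumConjStd (isStd_of_conj)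
open Summit.HodgeConjecture.HodgeConjecture.Cruxes.HLiu418.K2LiuArchMajorantTransitivity (exists_isSiegelDelta_conjDatum_arch_iff)

variable (L : Type) [Field L] [NumberField L] [IsCMField L]
variable {N M n : ℕ} (e : Fin N × Fin M ≃ Fin n)
  (dV : Fin N → L) (hdV : ∀ i, IsCMField.complexConj L (dV i) = dV i) (hdV0 : ∀ i, dV i ≠ 0)
  (dW : Fin M → L) (hdW : ∀ i, IsCMField.complexConj L (dW i) = dW i) (hdW0 : ∀ i, dW i ≠ 0)

include hdV0 hdW0 in
/-- **SOCKET #41 AT EVERY STANDARD DATUM FROM SOCKET #41 ON THE ARCHIMEDEAN CLASS OF A STANDARD REFERENCE DATUM `𝒦₁`.**  If for every STANDARD `𝒦` whose archimedean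
compact is `𝒦₁`'s (`∀ a, (a,1) ∈ 𝒦.K ↔ (a,1) ∈ 𝒦₁.K`) socket #41's conclusion `∃ P Es, (A1) ∧ … ∧ (A5)` holds for every standard continuous family of `(𝒦, χ)`, then it holds
for every standard continuous family `f′` of every standard `(𝒦₂, χ)` — ★ (T3-arch) `exists_isSiegelDelta_conjDatum_arch_iff` + ★ §5 `isStd_of_conj` + ★ glue
`continuation_of_conjDatum`. [cite: MoeglinWaldspurger1995, II.1.5, IV.1.8] [cite: BorelJacquet1979, §4.1] [cite: Weil1964, Chap. I n° 8] [cite: Tan1999, §1] -/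
theorem continuation_of_archReference (hn : 0 < n) {χ : HeckeCharacter L} {𝒦₁ : IwasawaDatum L e dV hdV dW hdW} (h₁ : 𝒦₁.IsStd)
    (h41 : ∀ 𝒦 : IwasawaDatum L e dV hdV dW hdW, 𝒦.IsStd →
      (∀ a : arch (Fp L) L (IsCMField.complexConj L) (n + n) (hermD L e dV hdV dW hdW),
        (archToAdelic (Fp L) L (IsCMField.complexConj L) (n + n) (hermD L e dV hdV dW hdW) a : HA L e dV hdV dW hdW) ∈ 𝒦.K ↔
          (archToAdelic (Fp L) L (IsCMField.complexConj L) (n + n) (hermD L e dV hdV dW hdW) a : HA L e dV hdV dW hdW) ∈ 𝒦₁.K) →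
      ∀ f : ℂ → HA L e dV hdV dW hdW → ℂ, IsStandardSectionFamily 𝒦 χ f → (∀ s, Continuous (f s)) →
      ∃ (P : Finset ℂ) (Es : ℂ → HA L e dV hdV dW hdW → ℂ),
        (∀ h : HA L e dV hdV dW hdW, DifferentiableOn ℂ (fun s => Es s h) {s : ℂ | 0 < s.re}) ∧
        (∀ s : ℂ, 0 < s.re → Continuous (Es s)) ∧
        (∀ s : ℂ, 0 < s.re → ∀ (γ : ratH L e dV hdV dW hdW) (h : HA L e dV hdV dW hdW), Es s ((γ : HA L e dV hdV dW hdW) * h) = Es s h) ∧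
        (∀ (s : ℂ) (h : HA L e dV hdV dW hdW), (n : ℝ) / 2 < s.re →
          Es s h = (∏ q ∈ P, (s - q)) * eisensteinFamilyDelta L e dV hdV dW hdW f s h) ∧
        (∀ z : ℂ, 0 < z.re → ∃ C A r : ℝ, 0 < r ∧ ∀ s : ℂ, dist s z < r → ∀ h : HA L e dV hdV dW hdW,
          ‖Es s h‖ ≤ C * adelicHeightGL (n + n) L (h : GL (Fin (n + n)) (AdeleRing (𝓞 L) L)) ^ A))
    {𝒦₂ : IwasawaDatum L e dV hdV dW hdW} (h₂ : 𝒦₂.IsStd)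
    (f' : ℂ → HA L e dV hdV dW hdW → ℂ) (hstd' : IsStandardSectionFamily 𝒦₂ χ f') (hcont' : ∀ s, Continuous (f' s)) :
    ∃ (P : Finset ℂ) (Es : ℂ → HA L e dV hdV dW hdW → ℂ),
      (∀ h : HA L e dV hdV dW hdW, DifferentiableOn ℂ (fun s => Es s h) {s : ℂ | 0 < s.re}) ∧
      (∀ s : ℂ, 0 < s.re → Continuous (Es s)) ∧
      (∀ s : ℂ, 0 < s.re → ∀ (γ : ratH L e dV hdV dW hdW) (h : HA L e dV hdV dW hdW), Es s ((γ : HA L e dV hdV dW hdW) * h) = Es s h) ∧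
      (∀ (s : ℂ) (h : HA L e dV hdV dW hdW), (n : ℝ) / 2 < s.re →
        Es s h = (∏ q ∈ P, (s - q)) * eisensteinFamilyDelta L e dV hdV dW hdW f' s h) ∧
      (∀ z : ℂ, 0 < z.re → ∃ C A r : ℝ, 0 < r ∧ ∀ s : ℂ, dist s z < r → ∀ h : HA L e dV hdV dW hdW,
        ‖Es s h‖ ≤ C * adelicHeightGL (n + n) L (h : GL (Fin (n + n)) (AdeleRing (𝓞 L) L)) ^ A) := by
  obtain ⟨p, 𝒦, hp, -, hK, harch⟩ := exists_isSiegelDelta_conjDatum_arch_iff L e dV hdV hdV0 dW hdW hdW0 h₁ h₂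
  have h𝒦 : 𝒦.IsStd := isStd_of_conj h₂ p hK
  have hc : ∀ k : HA L e dV hdV dW hdW, k ∈ 𝒦.K ↔ p⁻¹ * k * p⁻¹⁻¹ ∈ 𝒦₂.K := fun k => by rw [inv_inv]; exact hK k
  exact continuation_of_conjDatum L e dV hdV dW hdW hn 𝒦 𝒦₂ p⁻¹ hc (h41 𝒦 h𝒦 harch) f' hstd' hcont'

end Summit.HodgeConjecture.HodgeConjecture.Cruxes.HLiu418.K2LiuSiegelEisensteinArchClassTransport

end
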